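import Literature.AlgebraicGeometry.Motives.AbelianVarietySimpleOfIsogenyAnyField
import Literature.AlgebraicGeometry.Motives.AbelianVarietyIsoOfScheme
import Literature.AlgebraicGeometry.Motives.AlgPointsSeparate
import HarnessLib

/-!
# An abelian subvariety of full dimension is the whole abelian variety; a simple abelian variety has no abelian
# subvarieties other than `0` and itself — as ISOMORPHISMS (Milne 1986 §2 Cor. 2.2 / Rem. 2.3, §12 p. 122;
# Görtz–Wedhorn I Prop. 3.50)

Family `hodge`, layer `Literature/AlgebraicGeometry/Motives`; KERNEL ONLY (theorems; no definition, no instance, no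
named fact; net debt 0); every statement over an ARBITRARY field `K`.  Sequel of
`Motives/AbelianVarietySimpleOfIsogenyAnyField` (there: a closed-immersion homomorphism of full dimension is
SURJECTIVE, `surjective_of_isClosedImmersion_of_dim_eq`; a non-zero abelian subvariety of a simple abelian variety is
everything, `IsSimple.surjective_of_isClosedImmersion`) — here the same conclusions are upgraded from "surjective"
to "isomorphism of abelian varieties".

THE PRINT.  Milne, *Abelian Varieties* (in Cornell–Silverman 1986), §2 Cor. 2.2 and Remark 2.3 (PDF pp. 170–171:
«every morphism … is the composite of a homomorphism with a translation», «the group structure on `A` is uniquely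
determined by the choice of a zero element» — in the tree `AbelianVariety.isoOfOverIso`, `Motives/AbelianVarietyIsoOfScheme`:
an isomorphism of the underlying `K`-schemes preserving `0` is an isomorphism of abelian varieties), §12 p. 122 (PDF
p. 189: «Define an abelian variety to be simple if it has no proper nonzero abelian subvarieties»); Bombieri–Gubler,
*Heights* (2006), Def. 8.9.4 (PDF p. 260: «`B ≠ {0}` is called simple if `{0}` and `B` are its only abelian
subvarieties»); Görtz–Wedhorn, *Algebraic Geometry I* (2nd ed. 2020), Prop. 3.50 (PDF p. 114: `X_red` is the smallest
closed subscheme with the same underlying space — so a surjective closed immersion into a REDUCED scheme is an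
isomorphism; Mathlib `isIso_of_isClosedImmersion_of_surjective`), and *Algebraic Geometry II* (2023), proof of
Prop. 27.176 (iii) ⟹ (iv) (PDF p. 882: «`f(G)` is a closed subspace of `H` of the same dimension … As `H` is
irreducible, we see `f(G) = H`»).

Results (namespace `Literature.AlgebraicGeometry.Motives.AbelianVariety`):
* §1 `isIso_of_isIso_toSchemeHom` (**a homomorphism whose underlying morphism of schemes is an isomorphism is an
  isomorphism of abelian varieties** — Milne Cor. 2.2), `isIso_toSchemeHom_of_isIso`, `isIso_iff_isIso_toSchemeHom`;
* §2 `isIso_of_isClosedImmersion_of_surjective` (abelian varieties are reduced), **`isIso_of_isClosedImmersion_of_dim_eq`**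
  (an abelian subvariety of full dimension is everything), `isIso_toImage_of_isClosedImmersion` (`B ≅ im i` for a
  closed immersion `i`), **`isIso_imageι_of_surjective`** (`im f = Y` for surjective `f`), `isIso_imageι_iff_surjective`,
  `isIso_of_isIsogeny_of_isClosedImmersion` (an isogeny which is a closed immersion is an isomorphism);
* §3 **`IsSimple.isIso_of_isClosedImmersion`** (a non-zero abelian subvariety of a simple abelian variety IS the
  variety), **`isSimple_iff_forall_isClosedImmersion_isIso`** (Milne's wording of the definition: `A` is simple iff
  every abelian subvariety `B ↪ A` has `dim B = 0` or `B ↪ A` an isomorphism), `IsSimple.dim_eq_zero_or_isIso`.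

## References
* [Milne1986AbelianVarieties] J. S. Milne, *Abelian Varieties*, in Cornell–Silverman, *Arithmetic Geometry* (1986),
  §2 Cor. 2.2, Remark 2.3 (PDF pp. 170–171), §12 p. 122 (PDF p. 189).
* [GortzWedhorn2020] U. Görtz, T. Wedhorn, *Algebraic Geometry I: Schemes*, 2nd ed. (2020), Prop. 3.50 (PDF p. 114).
* [GortzWedhorn2023] U. Görtz, T. Wedhorn, *Algebraic Geometry II* (2023), Prop. 27.176 proof, Cor. 27.177 (PDF p. 882).
* [BombieriGubler2006] E. Bombieri, W. Gubler, *Heights in Diophantine Geometry* (2006), Def. 8.9.4 (PDF p. 260).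
* [MumfordAV1970] D. Mumford, *Abelian Varieties* (1970), §4 Cor. 1 (rigidity), §19 p. 173.
-/

noncomputable section

universe u

open CategoryTheory CategoryTheory.Limits AlgebraicGeometry

namespace Literature.AlgebraicGeometry.Motives.AbelianVariety

open scoped MonObj

variable {K : Type u} [Field K]

/-! ## §1 Homomorphisms that are isomorphisms of schemes are isomorphisms of abelian varieties -/

section SchemeIso

variable {B C : AbelianVariety K}

/-- **Milne 1986 Cor. 2.2 for a given homomorphism**: a homomorphism of abelian varieties whose underlying morphism
of schemes is an isomorphism is an isomorphism of abelian varieties (its inverse is again a homomorphism — the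
tree's `isoOfOverIso` built on rigidity, applied to the `K`-isomorphism underlying `f`, which preserves the origin
because `f` is a homomorphism). [cite: Milne1986AbelianVarieties, §2 Cor. 2.2 and Remark 2.3 (PDF pp. 170–171)]
[cite: MumfordAV1970, §4 Cor. 1 (rigidity)] -/
theorem isIso_of_isIso_toSchemeHom (f : B ⟶ C) [h : IsIso (Hom.toSchemeHom f)] : IsIso f := by
  haveI : IsIso ((Over.forget _).map f.hom.hom.hom) := h
  haveI : IsIso f.hom.hom.hom := isIso_of_reflects_iso f.hom.hom.hom (Over.forget _)
  have he : η[B.X] ≫ (asIso f.hom.hom.hom).hom = η[C.X] := by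
    rw [asIso_hom, IsMonHom.one_hom f.hom.hom.hom]
  have hf : (isoOfOverIso (asIso f.hom.hom.hom) he).hom = f :=
    hom_ext _ _ (by rw [isoOfOverIso_hom, asIso_hom])
  rw [← hf]
  infer_instance

/-- The underlying morphism of schemes of an isomorphism of abelian varieties is an isomorphism.
[cite: Milne1986AbelianVarieties, §2 Cor. 2.2 (PDF p. 170)] -/
theorem isIso_toSchemeHom_of_isIso (f : B ⟶ C) [IsIso f] : IsIso (Hom.toSchemeHom f) :=
  ⟨Hom.toSchemeHom (inv f), by
    change Hom.toSchemeHom (f ≫ inv f) = _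
    rw [IsIso.hom_inv_id]; rfl, by
    change Hom.toSchemeHom (inv f ≫ f) = _
    rw [IsIso.inv_hom_id]; rfl⟩

/-- A homomorphism of abelian varieties is an isomorphism iff its underlying morphism of schemes is.
[cite: Milne1986AbelianVarieties, §2 Cor. 2.2 and Remark 2.3 (PDF pp. 170–171)] -/
theorem isIso_iff_isIso_toSchemeHom (f : B ⟶ C) : IsIso f ↔ IsIso (Hom.toSchemeHom f) :=
  ⟨fun _ => isIso_toSchemeHom_of_isIso f, fun _ => isIso_of_isIso_toSchemeHom f⟩

end SchemeIso

/-! ## §2 Closed immersions of full dimension, images of closed immersions and of surjections -/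

section Closed

variable {B Y : AbelianVariety K}

/-- **A surjective closed-immersion homomorphism is an isomorphism** (abelian varieties are reduced: Görtz–Wedhorn I
Prop. 3.50, Mathlib `isIso_of_isClosedImmersion_of_surjective`; then §1).
[cite: GortzWedhorn2020, Prop. 3.50 (PDF p. 114)] [cite: Milne1986AbelianVarieties, §2 Cor. 2.2 (PDF p. 170)] -/
theorem isIso_of_isClosedImmersion_of_surjective (i : B ⟶ Y) [IsClosedImmersion (Hom.toSchemeHom i)]
    [Surjective (Hom.toSchemeHom i)] : IsIso i := by
  haveI := isReduced_left Y
  haveI := AlgebraicGeometry.isIso_of_isClosedImmersion_of_surjective (Hom.toSchemeHom i)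
  exact isIso_of_isIso_toSchemeHom i

/-- **An abelian subvariety of full dimension is the whole abelian variety**: a closed-immersion homomorphism
`i : B ↪ Y` with `dim B = dim Y` is an isomorphism (it is surjective since `Y` is irreducible,
`surjective_of_isClosedImmersion_of_dim_eq`). [cite: GortzWedhorn2023, proof of Prop. 27.176 (iii) ⟹ (iv) (PDF p. 882)]
[cite: GortzWedhorn2020, Prop. 3.50 (PDF p. 114)] -/
theorem isIso_of_isClosedImmersion_of_dim_eq (i : B ⟶ Y) [IsClosedImmersion (Hom.toSchemeHom i)]
    (h : B.dim = Y.dim) : IsIso i := by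
  haveI := surjective_of_isClosedImmersion_of_dim_eq i h
  exact isIso_of_isClosedImmersion_of_surjective i

/-- `B ≅ im i` for a closed-immersion homomorphism `i : B ↪ Y`: the corestriction `B ↠ im i` is an isomorphism
(it is a closed immersion — cancellation against the closed immersion `im i ↪ Y` — and surjective). [cite: GortzWedhorn2020, Prop. 3.50 (PDF p. 114)]
[cite: MumfordAV1970, §19 p. 173 (images of homomorphisms are abelian subvarieties)] -/
theorem isIso_toImage_of_isClosedImmersion (i : B ⟶ Y) [IsClosedImmersion (Hom.toSchemeHom i)] :
    IsIso (toImage i) := by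
  haveI : IsClosedImmersion (Hom.toSchemeHom (toImage i) ≫ Hom.toSchemeHom (imageι i)) := by
    change IsClosedImmersion (Hom.toSchemeHom (toImage i ≫ imageι i))
    rw [toImage_imageι]
    infer_instance
  haveI := IsClosedImmersion.of_comp_isClosedImmersion (Hom.toSchemeHom (toImage i))
    (Hom.toSchemeHom (imageι i))
  exact isIso_of_isClosedImmersion_of_surjective (toImage i)

/-- **`im f = Y` for a surjective homomorphism**: the closed immersion `im f ↪ Y` is surjective (as `f = (X ↠ im f) ≫
(im f ↪ Y)` is), hence an isomorphism. [cite: GortzWedhorn2023, Prop. 27.14 (1) (PDF p. 803)]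
[cite: GortzWedhorn2020, Prop. 3.50 (PDF p. 114)] -/
theorem isIso_imageι_of_surjective {X : AbelianVariety K} (f : X ⟶ Y) [h : Surjective (Hom.toSchemeHom f)] :
    IsIso (imageι f) := by
  haveI : Surjective (Hom.toSchemeHom (toImage f) ≫ Hom.toSchemeHom (imageι f)) := by
    change Surjective (Hom.toSchemeHom (toImage f ≫ imageι f))
    rw [toImage_imageι]
    exact h
  haveI : Surjective (Hom.toSchemeHom (imageι f)) := Surjective.of_comp (Hom.toSchemeHom (toImage f)) _
  exact isIso_of_isClosedImmersion_of_surjective (imageι f)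

/-- `im f ↪ Y` is an isomorphism iff `f` is surjective. [cite: GortzWedhorn2023, Prop. 27.14 (1) (PDF p. 803)] -/
theorem isIso_imageι_iff_surjective {X : AbelianVariety K} (f : X ⟶ Y) :
    IsIso (imageι f) ↔ Surjective (Hom.toSchemeHom f) := by
  refine ⟨fun _ => ?_, fun _ => isIso_imageι_of_surjective f⟩
  haveI := isIso_toSchemeHom_of_isIso (imageι f)
  rw [← toImage_imageι f]
  change Surjective (Hom.toSchemeHom (toImage f) ≫ Hom.toSchemeHom (imageι f))
  infer_instance

/-- **An isogeny which is a closed immersion is an isomorphism** (a "degree-one" isogeny; surjective closed immersion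
into a reduced scheme). [cite: GortzWedhorn2020, Prop. 3.50 (PDF p. 114)] [cite: Milne1986AbelianVarieties, §8 Prop. 8.1 (PDF p. 180)] -/
theorem isIso_of_isIsogeny_of_isClosedImmersion {f : B ⟶ Y} (hf : IsIsogeny f)
    [IsClosedImmersion (Hom.toSchemeHom f)] : IsIso f := by
  haveI := hf.1
  exact isIso_of_isClosedImmersion_of_surjective f

end Closed

/-! ## §3 A simple abelian variety has no abelian subvarieties other than `0` and itself -/

section Simple

variable {A B : AbelianVariety K}

/-- **A non-zero abelian subvariety of a SIMPLE abelian variety is the whole variety, as an isomorphism** (Milne's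
definition «no proper nonzero abelian subvarieties», Bombieri–Gubler's «`{0}` and `B` are its only abelian
subvarieties»): a closed-immersion homomorphism `i : B ↪ A` with `0 < dim B` is an isomorphism — it is surjective
(`IsSimple.surjective_of_isClosedImmersion`), hence an isomorphism of schemes, hence of abelian varieties.
[cite: Milne1986AbelianVarieties, §12 p. 122 (PDF p. 189)] [cite: BombieriGubler2006, Def. 8.9.4 (PDF p. 260)]
[cite: GortzWedhorn2020, Prop. 3.50 (PDF p. 114)] -/
theorem IsSimple.isIso_of_isClosedImmersion (hA : IsSimple A) (i : B ⟶ A)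
    [IsClosedImmersion (Hom.toSchemeHom i)] (hB : 0 < B.dim) : IsIso i := by
  haveI := hA.surjective_of_isClosedImmersion i hB
  exact isIso_of_isClosedImmersion_of_surjective i

/-- For a simple `A`, every abelian subvariety `i : B ↪ A` has `dim B = 0` or is an isomorphism.
[cite: Milne1986AbelianVarieties, §12 p. 122 (PDF p. 189)] [cite: BombieriGubler2006, Def. 8.9.4 (PDF p. 260)] -/
theorem IsSimple.dim_eq_zero_or_isIso (hA : IsSimple A) (i : B ⟶ A) [IsClosedImmersion (Hom.toSchemeHom i)] :
    B.dim = 0 ∨ IsIso i := by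
  rcases Nat.eq_zero_or_pos B.dim with h0 | hB
  · exact Or.inl h0
  · exact Or.inr (hA.isIso_of_isClosedImmersion i hB)

/-- **Milne's wording of simplicity, as a theorem**: `A` is simple (no abelian subvariety `B ↪ A` with
`0 < dim B < dim A`) iff every abelian subvariety `B ↪ A` is zero-dimensional or the inclusion is an isomorphism.
[cite: Milne1986AbelianVarieties, §12 p. 122 (PDF p. 189)] [cite: BombieriGubler2006, Def. 8.9.4 (PDF p. 260)]
[cite: Lang1983AbelianVarieties, II §1 p. 26] -/
theorem isSimple_iff_forall_isClosedImmersion_isIso :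
    IsSimple A ↔ ∀ (B : AbelianVariety K) (i : B ⟶ A), IsClosedImmersion (Hom.toSchemeHom i) →
      B.dim = 0 ∨ IsIso i := by
  constructor
  · intro hA B i hi
    haveI := hi
    exact hA.dim_eq_zero_or_isIso i
  · intro h B i hi h0 hlt
    rcases h B i hi with h0' | hiso
    · omega
    · haveI := hiso
      have hdim : B.dim = A.dim := dim_eq_of_isIsogeny (isIsogeny_hom_of_iso (asIso i))
      omega

end Simple

end Literature.AlgebraicGeometry.Motives.AbelianVariety

end
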